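import Literature.NumberTheory.GaussSums.KummerSector
import Literature.Computability.Complexity.Oracle
import Literature.Computability.Complexity.Randomized

/-!
# Birth skeleton (BC3) for the split child `ArgLegClassicalBase` (X₄) of `ArgLeg` (stmt-QuantumAdvantage-14637)

`ArgLegClassicalBase`: a polynomial-time oracle algorithm `G ∈ FP^{KummerSector}` with coins writes, with
probability `≥ 3/4`, the 7 bits of `(n₂ + n₃) mod 72` for some certificate `(g, k, n₂, n₃, a, b, u, v, w)` — `g` a
primitive root with `g^{(p-1)/3} ≡ r`, `k` its Kummer sector (oracle), `π = a + bω` primary dividing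
`g^{(p-1)/3} − ω`, `n₃` pinning `arg π/3 + 2πk/3` to `±π/36`, `n₂` pinning `arg T_p` to `±π/8`,
`T_p = Σ_{a<3p} χ̄_p(a)ψ₃(a) cot(πa/3p) = (6p/π) L(1, θ̄)`.  Line: the two ANALYTIC inputs are isolated as stubs
over the finite object `T_p` — STUB 1 an effective lower bound `‖T_p‖ ≥ c·p/log(3p)` (Landau: `|L(1,θ̄)| ≫ 1/log 3p`
for the complex character `θ̄`; numerics: `‖T_p‖ log(3p)/p ≥ 5.13` for `p < 400`), STUB 2 the truncation
`‖T_p − (6p/π) Σ_{n≤M} θ̄(n)/n‖ ≤ C p√p log p / M` (cotangent formula for `L(1, θ̄)` + Pólya–Vinogradov tail;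
numerics: `C ≤ 0.34` at `M ∈ {p, 4p}`, `p < 400`) — and STUB 3 is the MACHINE: sample `g`, certify primitivity and
read the sector with three oracle queries, Euclid in `ℤ[ω]` for `π` and `n₃`, dyadic-block Monte-Carlo for
`Σ_{n≤M} θ̄(n)/n` (Hoeffding) and `n₂`, in the tree's `FPRel` model (AdaptivePrograms-style programming).
-/

set_option linter.dupNamespace false -- `QuantumAdvantage.QuantumAdvantage` is the D-0017 nested layout

namespace Summit.QuantumAdvantage.QuantumAdvantage.Cruxes.ArgLeg.ArgLegClassicalBaseBirth

open _root_.Computability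
open Literature.Computability.Complexity (boolPair FPRel uniformProb)
open Literature.NumberTheory.GaussSums

/-- The split child, verbatim (defeq to the route decl once installed). -/
def ArgLegClassicalBase : Prop :=
  ∃ G : List Bool → List Bool, G ∈ Literature.Computability.Complexity.FPRel (Literature.Computability.Complexity.Oracle.ofLanguage Literature.NumberTheory.GaussSums.KummerSector) ∧ ∃ q : Polynomial ℕ, ∀ x : List Bool, (3 : ℝ) / 4 ≤ Literature.Computability.Complexity.uniformProb (q.eval x.length) {c | G (Literature.Computability.Complexity.boolPair x c) ∈ {z : List Bool | ∀ p r : ℕ, Computability.decodeNat x = p → p.Prime → p % 3 = 1 → r < p → (r * r + r + 1) % p = 0 → 2 * r + 1 < p → ∃ (g k n₂ n₃ : ℕ) (a b u v w : ℤ), IsPrimitiveRoot (g : ZMod p) (p - 1) ∧ (g : ZMod p) ^ ((p - 1) / 3) = (r : ZMod p) ∧ (Literature.NumberTheory.GaussSums.kummerSectorIndex p g : ℕ) = k ∧ a % 3 = 2 ∧ b % 3 = 0 ∧ a * a - a * b + b * b = (p : ℤ) ∧ (((g ^ ((p - 1) / 3) % p : ℕ) : ℂ) - Literature.NumberTheory.GaussSums.omega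 = ((a : ℂ) + (b : ℂ) * Literature.NumberTheory.GaussSums.omega) * ((u : ℂ) + (v : ℂ) * Literature.NumberTheory.GaussSums.omega)) ∧ |Complex.arg ((a : ℂ) + (b : ℂ) * Literature.NumberTheory.GaussSums.omega) / 3 + 2 * Real.pi * (k : ℝ) / 3 - 2 * Real.pi * (n₃ : ℝ) / 72 + 2 * Real.pi * (w : ℝ)| ≤ Real.pi / 36 ∧ |Complex.arg ((∑ a ∈ Finset.range (3 * p), ((if (a : ZMod p) = 0 then (0 : ℂ) else if (a : ZMod p) ^ ((p - 1) / 3) = 1 then 1 else if (a : ZMod p) ^ ((p - 1) / 3) = (r : ZMod p) then Complex.exp (2 * Real.pi * Complex.I / 3) ^ 2 else Complex.exp (2 * Real.pi * Complex.I / 3)) * (if a % 3 = 1 then (1 : ℂ) else if a % 3 = 2 then -1 else 0) * (Real.cot (Real.pi * a / (3 * p)) : ℂ))) * Complex.exp (-(2 * Real.pi * Complex.I * (n₂ : ℂ) / 72)))| ≤ Real.pi / 8 ∧ List.ofFn (fun i : Fin 7 => ((n₂ + n₃) % 72).testBit i.val) <+: z}}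

/-- The odd sextic character `θ̄ = χ̄_p ψ₃ mod 3p` as a total function of `n : ℕ` (verbatim summand factors). -/
noncomputable def thetaBar (p r n : ℕ) : ℂ :=
  (if (n : ZMod p) = 0 then (0 : ℂ) else if (n : ZMod p) ^ ((p - 1) / 3) = 1 then 1 else if (n : ZMod p) ^ ((p - 1) / 3) = (r : ZMod p) then Complex.exp (2 * Real.pi * Complex.I / 3) ^ 2 else Complex.exp (2 * Real.pi * Complex.I / 3)) * (if n % 3 = 1 then (1 : ℂ) else if n % 3 = 2 then -1 else 0)

/-- `T_p(r) = Σ_{a<3p} θ̄(a) cot(πa/3p)` (verbatim summand of the statement). -/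
noncomputable def T (p r : ℕ) : ℂ :=
  ∑ a ∈ Finset.range (3 * p), (thetaBar p r a * (Real.cot (Real.pi * a / (3 * p)) : ℂ))

/-- STUB 1 (effective Landau lower bound, finite form): `‖T_p‖ ≥ c·p / log(3p)` with an ABSOLUTE `c > 0`, i.e.
`|L(1, θ̄)| ≥ (πc/6)/log(3p)` for the complex primitive character `θ̄` mod `3p` (no exceptional zero for complex
characters). Numerics: `‖T_p‖·log(3p)/p ≥ 5.13` for all `p ≡ 1 (3)` below 400. [MontgomeryVaughan2007, Thm 11.4 and §11.2] -/
theorem stub_T_lower : ∃ c : ℝ, 0 < c ∧ ∀ p r : ℕ, p.Prime → p % 3 = 1 → r < p → (r * r + r + 1) % p = 0 →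
    2 * r + 1 < p → c * p / Real.log (3 * p) ≤ ‖T p r‖ := by
  sorry

/-- STUB 2 (cotangent formula + Pólya–Vinogradov tail, finite form): `T_p = (6p/π)·L(1, θ̄)` and
`L(1, θ̄) = Σ_{n≤M} θ̄(n)/n + O(√(3p) log(3p)/M)`, hence `‖T_p − (6p/π) Σ_{n≤M} θ̄(n)/n‖ ≤ C·p·√p·log p / M`.
Numerics: `C ≤ 0.34` suffices at `M ∈ {p, 4p}`, `p < 400`. [MontgomeryVaughan2007, Thm 9.18 (Pólya–Vinogradov), §4.3] -/
theorem stub_T_truncation : ∃ C : ℝ, ∀ p r M : ℕ, p.Prime → p % 3 = 1 → r < p → (r * r + r + 1) % p = 0 →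
    2 * r + 1 < p → 0 < M →
    ‖T p r - (6 * p / Real.pi : ℂ) * ∑ n ∈ Finset.Icc 1 M, thetaBar p r n / n‖
      ≤ C * p * Real.sqrt p * Real.log p / M := by
  sorry

/-- STUB 3 (the machine, Arora–Barak Ch. 7 + BBBV 1997 §4 interface): given the two analytic inputs, a
`BPP^{KummerSector}` algorithm with the certified output exists — sample `g < p` until the oracle accepts
`⟨p, g^{±1}, k⟩` for some `k < 3` (this certifies primitivity and reads the sector; invert `g` if
`g^{(p-1)/3} ≡ r²`), Euclid in `ℤ[ω]` for the primary `π ∣ g^{(p-1)/3} − ω` and `n₃` by exact arithmetic on `arg π`,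
dyadic-block Monte-Carlo for `Σ_{n≤p²} θ̄(n)/n` to absolute error `≤ (sin π/9)·(πc/6)/log(3p)` (Hoeffding,
`poly(log p)` samples) and `n₂` by rounding; failure probability `≤ 1/4`; programmed in `FPRel`
(AdaptivePrograms). [AroraBarak2009, §7; BennettBernsteinBrassardVazirani1997, §4] -/
theorem stub_machine
    (h1 : ∃ c : ℝ, 0 < c ∧ ∀ p r : ℕ, p.Prime → p % 3 = 1 → r < p → (r * r + r + 1) % p = 0 →
      2 * r + 1 < p → c * p / Real.log (3 * p) ≤ ‖T p r‖)
    (h2 : ∃ C : ℝ, ∀ p r M : ℕ, p.Prime → p % 3 = 1 → r < p → (r * r + r + 1) % p = 0 →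
      2 * r + 1 < p → 0 < M →
      ‖T p r - (6 * p / Real.pi : ℂ) * ∑ n ∈ Finset.Icc 1 M, thetaBar p r n / n‖
        ≤ C * p * Real.sqrt p * Real.log p / M) :
    ArgLegClassicalBase := by
  sorry

/-- COMPOSITION (kernel-checked, no sorry): the three stubs give `ArgLegClassicalBase`. -/
theorem ArgLegClassicalBase_of
    (h1 : ∃ c : ℝ, 0 < c ∧ ∀ p r : ℕ, p.Prime → p % 3 = 1 → r < p → (r * r + r + 1) % p = 0 →
      2 * r + 1 < p → c * p / Real.log (3 * p) ≤ ‖T p r‖)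
    (h2 : ∃ C : ℝ, ∀ p r M : ℕ, p.Prime → p % 3 = 1 → r < p → (r * r + r + 1) % p = 0 →
      2 * r + 1 < p → 0 < M →
      ‖T p r - (6 * p / Real.pi : ℂ) * ∑ n ∈ Finset.Icc 1 M, thetaBar p r n / n‖
        ≤ C * p * Real.sqrt p * Real.log p / M)
    (h3 : (∃ c : ℝ, 0 < c ∧ ∀ p r : ℕ, p.Prime → p % 3 = 1 → r < p → (r * r + r + 1) % p = 0 →
      2 * r + 1 < p → c * p / Real.log (3 * p) ≤ ‖T p r‖) →
      (∃ C : ℝ, ∀ p r M : ℕ, p.Prime → p % 3 = 1 → r < p → (r * r + r + 1) % p = 0 →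
      2 * r + 1 < p → 0 < M →
      ‖T p r - (6 * p / Real.pi : ℂ) * ∑ n ∈ Finset.Icc 1 M, thetaBar p r n / n‖
        ≤ C * p * Real.sqrt p * Real.log p / M) → ArgLegClassicalBase) :
    ArgLegClassicalBase :=
  h3 h1 h2

end Summit.QuantumAdvantage.QuantumAdvantage.Cruxes.ArgLeg.ArgLegClassicalBaseBirth
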